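import Summits.QuantumFields.BalabanUV.Beta.EriceFlowEnclosureB12AsPrintedHistoryContagionShiftFlowZeroTangentProduct

/-!
# Beta / EriceFlowEnclosureB12AsPrintedHistoryContagionShiftFlowZeroTangentProductWitness — ASYMPTOTIC FREEDOM IS CONTAGIOUS, part 87: THE PRODUCT FORMULA IN CLOSED FORM ON
# THE QUADRATIC FUNCTIONAL.  For the NON-constant def-free toy `B u = c + κ₀u₀²` of part 73 (gradient `G u j = 2κ₀u₀·[j = 0]`; NOT Bałaban's β) the tangent equation of part 68
# collapses, row by row, to its youngest term: **`W_k = 1 − κ₀Σ_{p<k} h_{p+1}⁴W_{p+1}`**, hence the one-step recursion **`W_{k+1}·(1 + κ₀h_{k+1}⁴) = W_k`** and, for `κ₀ ≥ 0`,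
# the CLOSED FORM **`W_k = Π_{i<k} (1 + κ₀h_{i+1}⁴)⁻¹`**; in particular the ONE-STEP TANGENT FACTOR of part 76 is **`ω(x) = (1 + κ₀h_1(x)⁴)⁻¹`** — a deviation of FOURTH order
# in the coupling, inside part 76's cube law — and part 76's product formula `W_k(e) = Π_{i<k} ω(h_i(e))` is this closed form read through `h_1(h_i(e)) = h_{i+1}(e)`
# (`solution_tail`).  Purely algebraic: no package hypothesis is needed for the recursion (any h, any W satisfying the equation); the identification with part 76's ω uses a
# tangent field on ]0, e′]
# (β-flow team, prover 1, unit `b2b-balaban-beta-bflow-p1`, gen 43; ROW AP-I·Uc × NODE U2)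

HONEST FRAMING (page 1 of everything the β sub-cell writes): discharging `BetaPertH` makes Bałaban's UV stability UNCONDITIONAL — a
real constructive-QFT result; it is NOT the continuum limit and NOT the Clay problem.  HONEST DEPENDENCY (cell reorg 2026-08-19,
verbatim): «continuum YM on T⁴ ⇐ BetaPertH ∧ nine spine estimates (0/9 proved); BetaPertH ⇐ (D1) ∧ (D4) ∧ CAP+tail; G-an2-4 gates
asym, D1 and NE2/3/4.»  THIS MODULE DISCHARGES NOTHING: [folklore] algebra (`tsum_eq_single`, telescoping of a finite sum, induction on the scale) over the tangent equation of
part 68 for ONE def-free toy functional; parts 68, 75, 76 BY NAME.  [I] = T. Bałaban, Commun. Math. Phys. **109** (1987) [Balaban1987RG1] prints the recursion (0.20) p. 256 and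
Theorem 2 (0.31) p. 259 (STATED WITHOUT PROOF); the toy is NOT Bałaban's β and nothing of Bałaban's β is asserted.

WHAT THIS FILE PROVES (0 sorry, 0 def): §159 `quad_row_eq`, **`quad_tangent_eq`**, **`quad_tangent_succ_mul`**, **`quad_tangent_closed_form`**, `quad_tangent_pos_le_one`;
§160 **`quad_oneStep_factor`**, **`quad_tangentField_closed_form`**.  NOT CLAIMED: anything about Bałaban's β; `BetaPertH`; the continuum limit of the measures; Clay.
-/

namespace Summit.QuantumFields.BalabanUV.Beta.EriceFlowEnclosureB12AsPrintedHistoryContagionShiftFlowZeroTangentProductWitness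

open Finset Filter Topology Set
open Literature.MathematicalPhysics.QuantumFieldTheory.Balaban1983to89
open Literature.MathematicalPhysics.QuantumFieldTheory.Balaban1983to89.T4CouplingMatching (sprof)
open Literature.MathematicalPhysics.QuantumFieldTheory.Balaban1983to89.T4BetaStationary (SeqBox MemoryProfile)
open Literature.MathematicalPhysics.QuantumFieldTheory.Balaban1983to89.T4BetaFlowWellPosed (MemFlow solution)
open Summit.QuantumFields.BalabanUV.Beta.EriceFlowEnclosureB12AsPrintedHistoryContagionShiftFlowZeroTangentFlow (solution_facts)
open Summit.QuantumFields.BalabanUV.Beta.EriceFlowEnclosureB12AsPrintedHistoryContagionShiftFlowZeroTangentCocycle (solution_tail_of_le_half)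
open Summit.QuantumFields.BalabanUV.Beta.EriceFlowEnclosureB12AsPrintedHistoryContagionShiftFlowZeroTangentProduct (tangentField_eq_prod)

noncomputable section

/-! ## §159 The tangent equation of the quadratic functional: youngest-term collapse, one-step recursion, closed form -/

/-- The row of the tangent equation for the gradient `G u j = 2κ₀u₀·[j = 0]` keeps only its youngest term: `Σ_j G(h_{p+1+·}) j (h_{p+1+j}³∕2) W_{p+1+j} = κ₀h_{p+1}⁴W_{p+1}`.
[folklore] -/
theorem quad_row_eq (κ₀ : ℝ) (h W : ℕ → ℝ) (p : ℕ) :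
    ∑' j, (fun (u : ℕ → ℝ) (j : ℕ) => if j = 0 then 2 * κ₀ * u 0 else 0) (fun i => h (p + 1 + i)) j * ((h (p + 1 + j)) ^ 3 / 2) * W (p + 1 + j)
      = κ₀ * (h (p + 1)) ^ 4 * W (p + 1) := by
  rw [tsum_eq_single 0 (fun j hj => by simp [hj])]
  simp only [if_true, add_zero]
  ring

/-- **THE TANGENT EQUATION OF THE QUADRATIC FUNCTIONAL**: for `G u j = 2κ₀u₀·[j = 0]`, any sequences h, W with part 68's tangent equation along h satisfy
**`W_k = 1 − κ₀·Σ_{p<k} h_{p+1}⁴·W_{p+1}`** for every k. [folklore] -/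
theorem quad_tangent_eq {κ₀ : ℝ} {h W : ℕ → ℝ}
    (hW : ∀ k, W k = 1 - ∑ p ∈ range k, ∑' j,
      (fun (u : ℕ → ℝ) (j : ℕ) => if j = 0 then 2 * κ₀ * u 0 else 0) (fun i => h (p + 1 + i)) j * ((h (p + 1 + j)) ^ 3 / 2) * W (p + 1 + j)) (k : ℕ) :
    W k = 1 - κ₀ * ∑ p ∈ range k, (h (p + 1)) ^ 4 * W (p + 1) := by
  rw [hW k, Finset.mul_sum]
  congr 1
  refine Finset.sum_congr rfl fun p _ => ?_
  rw [quad_row_eq]; ring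

/-- **THE ONE-STEP RECURSION**: `W_{k+1}·(1 + κ₀h_{k+1}⁴) = W_k` (subtract two consecutive instances of `quad_tangent_eq`). [folklore] -/
theorem quad_tangent_succ_mul {κ₀ : ℝ} {h W : ℕ → ℝ}
    (hW : ∀ k, W k = 1 - ∑ p ∈ range k, ∑' j,
      (fun (u : ℕ → ℝ) (j : ℕ) => if j = 0 then 2 * κ₀ * u 0 else 0) (fun i => h (p + 1 + i)) j * ((h (p + 1 + j)) ^ 3 / 2) * W (p + 1 + j)) (k : ℕ) :
    W (k + 1) * (1 + κ₀ * (h (k + 1)) ^ 4) = W k := by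
  have h1 := quad_tangent_eq hW (k + 1)
  have h0 := quad_tangent_eq hW k
  rw [Finset.sum_range_succ] at h1
  rw [h0]
  linear_combination h1

/-- **THE CLOSED FORM**: for `κ₀ ≥ 0`, **`W_k = Π_{i<k} (1 + κ₀h_{i+1}⁴)⁻¹`** (induction on the scale over the one-step recursion; `W_0 = 1`). [folklore] -/
theorem quad_tangent_closed_form {κ₀ : ℝ} {h W : ℕ → ℝ} (hκ : 0 ≤ κ₀)
    (hW : ∀ k, W k = 1 - ∑ p ∈ range k, ∑' j,
      (fun (u : ℕ → ℝ) (j : ℕ) => if j = 0 then 2 * κ₀ * u 0 else 0) (fun i => h (p + 1 + i)) j * ((h (p + 1 + j)) ^ 3 / 2) * W (p + 1 + j)) (k : ℕ) :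
    W k = ∏ i ∈ range k, (1 + κ₀ * (h (i + 1)) ^ 4)⁻¹ := by
  induction k with
  | zero => rw [hW 0]; simp
  | succ k ih =>
    have hpos : 0 < 1 + κ₀ * (h (k + 1)) ^ 4 := by positivity
    have hrec := quad_tangent_succ_mul hW k
    rw [Finset.prod_range_succ, ← ih, ← hrec]
    field_simp

/-- For `κ₀ ≥ 0` the tangent flow of the quadratic functional is in `]0, 1]` at every scale (each factor is). [folklore] -/
theorem quad_tangent_pos_le_one {κ₀ : ℝ} {h W : ℕ → ℝ} (hκ : 0 ≤ κ₀)
    (hW : ∀ k, W k = 1 - ∑ p ∈ range k, ∑' j,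
      (fun (u : ℕ → ℝ) (j : ℕ) => if j = 0 then 2 * κ₀ * u 0 else 0) (fun i => h (p + 1 + i)) j * ((h (p + 1 + j)) ^ 3 / 2) * W (p + 1 + j)) (k : ℕ) :
    0 < W k ∧ W k ≤ 1 := by
  rw [quad_tangent_closed_form hκ hW k]
  refine ⟨Finset.prod_pos fun i _ => inv_pos.mpr (by positivity), ?_⟩
  refine Finset.prod_le_one (fun i _ => (inv_pos.mpr (by positivity)).le) fun i _ => ?_
  exact inv_le_one_of_one_le₀ (by nlinarith [pow_nonneg (sq_nonneg (h (i + 1))) 1, sq_nonneg ((h (i + 1)) ^ 2)])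

/-! ## §160 The one-step tangent factor of the quadratic functional and part 76's product formula, in closed form -/

/-- **THE ONE-STEP TANGENT FACTOR OF THE QUADRATIC FUNCTIONAL IS `ω(x) = (1 + κ₀h_1(x)⁴)⁻¹`**: for a tangent field Wf of `B u = c + κ₀u₀²` (part 76's binder shape, the
gradient spelled as the lambda of part 73) and `κ₀ ≥ 0`, at every pin `x ∈ ]0, e′]`: `Wf x 1 = (1 + κ₀(solution B x 1)⁴)⁻¹` — a deviation from 1 of FOURTH order in the
coupling (inside part 76's cube law). [folklore] -/
theorem quad_oneStep_factor {c κ₀ e' : ℝ} {Wf : ℝ → ℕ → ℝ} (hκ : 0 ≤ κ₀)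
    (hWf : ∀ x ∈ Ioc (0 : ℝ) e',
      (∀ k, Wf x k = 1 - ∑ p ∈ range k, ∑' j, (fun (u : ℕ → ℝ) (j : ℕ) => if j = 0 then 2 * κ₀ * u 0 else 0)
          (fun i => solution (fun u : ℕ → ℝ => c + κ₀ * (u 0) ^ 2) x (p + 1 + i)) j
        * ((solution (fun u : ℕ → ℝ => c + κ₀ * (u 0) ^ 2) x (p + 1 + j)) ^ 3 / 2) * Wf x (p + 1 + j)) ∧ ∀ k, |Wf x k| ≤ 2)
    {x : ℝ} (hx : x ∈ Ioc (0 : ℝ) e') :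
    Wf x 1 = (1 + κ₀ * (solution (fun u : ℕ → ℝ => c + κ₀ * (u 0) ^ 2) x 1) ^ 4)⁻¹ := by
  rw [quad_tangent_closed_form hκ (hWf x hx).1 1]
  simp

/-- **PART 76's PRODUCT FORMULA IN CLOSED FORM**: under part 14's package at e′ for the quadratic functional (its memory profile is part 73's `quad_memoryProfile`; the gradient
profile `hG` its `quad_letters`), a tangent field Wf, `κ₀ ≥ 0`, `e ∈ ]0, e′]` with `2e ≤ e′`:
**`Wf e k = Π_{i<k} ω(h_i(e)) = Π_{i<k} (1 + κ₀h_{i+1}(e)⁴)⁻¹`** — part 76's product of one-step factors and §159's closed form coincide factor by factor, because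
`h_1(h_i(e)) = h_{i+1}(e)` (part 75's `solution_tail`). [cite: Balaban1987RG1, Thm 2 (0.31) p.259 with (0.20) p.256 and p.298] -/
theorem quad_tangentField_closed_form {c κ₀ Cm θ γ bs ta gs e' : ℝ} {t : ℕ → ℝ} {Wf : ℝ → ℕ → ℝ} (hκ : 0 ≤ κ₀)
    (hB : MemoryProfile Cm θ γ (fun u : ℕ → ℝ => c + κ₀ * (u 0) ^ 2)) (hCm : 0 ≤ Cm) (hθ0 : 0 ≤ θ) (hθ1 : θ < 1) (hbs : 0 < bs) (hta : 0 < ta)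
    (hts : SeqBox γ t) (htf : MemFlow (fun u : ℕ → ℝ => c + κ₀ * (u 0) ^ 2) gs t) (hprof : ∀ m : ℕ, 1 / ta ^ 2 + bs * (m : ℝ) ≤ 1 / (t m) ^ 2)
    (hG : ∀ u : ℕ → ℝ, SeqBox γ u → ∀ j, |(fun (u : ℕ → ℝ) (j : ℕ) => if j = 0 then 2 * κ₀ * u 0 else 0) u j| ≤ Cm * θ ^ j)
    (h2e' : 2 * e' ≤ γ) (hs1 : 4 * Cm * e' ≤ bs * (1 - θ))
    (hs2 : e' ^ 2 * (1 / gs ^ 2 + Cm * γ / (1 - θ) ^ 2 + (2 * Cm / ((1 - θ) * bs)) ^ 2) ≤ 3 / 4)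
    (hs4 : 64 * Cm * e' ^ 3 ≤ (1 - θ) ^ 2) (hs5 : Cm * (8 * e' ^ 3 + 16 * e' / bs) ≤ (1 - θ) / 4)
    (hWf : ∀ x ∈ Ioc (0 : ℝ) e',
      (∀ k, Wf x k = 1 - ∑ p ∈ range k, ∑' j, (fun (u : ℕ → ℝ) (j : ℕ) => if j = 0 then 2 * κ₀ * u 0 else 0)
          (fun i => solution (fun u : ℕ → ℝ => c + κ₀ * (u 0) ^ 2) x (p + 1 + i)) j
        * ((solution (fun u : ℕ → ℝ => c + κ₀ * (u 0) ^ 2) x (p + 1 + j)) ^ 3 / 2) * Wf x (p + 1 + j)) ∧ ∀ k, |Wf x k| ≤ 2)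
    {e : ℝ} (he : e ∈ Ioc (0 : ℝ) e') (h2e : 2 * e ≤ e') (k : ℕ) :
    Wf e k = ∏ i ∈ range k, Wf (solution (fun u : ℕ → ℝ => c + κ₀ * (u 0) ^ 2) e i) 1 ∧
      Wf e k = ∏ i ∈ range k, (1 + κ₀ * (solution (fun u : ℕ → ℝ => c + κ₀ * (u 0) ^ 2) e (i + 1)) ^ 4)⁻¹ ∧
      ∀ i, Wf (solution (fun u : ℕ → ℝ => c + κ₀ * (u 0) ^ 2) e i) 1 = (1 + κ₀ * (solution (fun u : ℕ → ℝ => c + κ₀ * (u 0) ^ 2) e (i + 1)) ^ 4)⁻¹ := by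
  obtain ⟨hsb, -⟩ := solution_facts hB hCm hθ0 hθ1 hbs hta hts htf hprof h2e' hs1 hs2 hs4 hs5 he
  have hfac : ∀ i, Wf (solution (fun u : ℕ → ℝ => c + κ₀ * (u 0) ^ 2) e i) 1
      = (1 + κ₀ * (solution (fun u : ℕ → ℝ => c + κ₀ * (u 0) ^ 2) e (i + 1)) ^ 4)⁻¹ := by
    intro i
    obtain ⟨hk, htail⟩ := solution_tail_of_le_half hB hCm hθ0 hθ1 hbs hta hts htf hprof h2e' hs1 hs2 hs4 hs5 he h2e i
    have hx : solution (fun u : ℕ → ℝ => c + κ₀ * (u 0) ^ 2) e i ∈ Ioc (0 : ℝ) e' := ⟨(hsb i).1, hk⟩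
    rw [quad_oneStep_factor hκ hWf hx, congrFun htail 1]
  exact ⟨tangentField_eq_prod hB hCm hθ0 hθ1 hbs hta hts htf hprof hG h2e' hs1 hs2 hs4 hs5 hWf he h2e k, quad_tangent_closed_form hκ (hWf e he).1 k, hfac⟩

end

end Summit.QuantumFields.BalabanUV.Beta.EriceFlowEnclosureB12AsPrintedHistoryContagionShiftFlowZeroTangentProductWitness
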